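import Summits.NavierStokesRegularity.NavierStokesRegularity.Theorems.ClockStretchingLawClockCeilingContinuousAlignmentRegular
import HarnessLib

/-!
# Route ClockStretchingLaw, crux `ClockCeiling` (stmt-NavierStokesRegularity-10570) — signed (parallel
# OR antiparallel) alignment of the vorticity direction already forces regularity of a Type-I model

Line `registered`, lead c7, stub `stub_signedAlignmentRegular` (`--supports 10570`).

`ClockStretchingLawClockCeilingContinuousAlignmentRegular.lean` proves Giga–Miura's Theorem 1.1
inside the route class `𝒦_C`: a `t`-uniform spatial modulus of continuity of `ξ = ω/|ω|` on the
high-vorticity set excludes a singularity. Giga–Miura measure alignment by `‖ξ(t,x) − ξ(t,y)‖`,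
which is of order one across an ANTIPARALLEL vortex pair or layer — the geometry of the classical
reconnection scenario — whereas Constantin–Fefferman (1993) and Beirão da Veiga–Berselli (2002)
measure it by the SINE of the angle, `|ξ(x) × ξ(y)|`, blind to orientation. Since the unidirectional
Liouville theorem `unidirectionalVorticityLiouville` only asks the vorticity of each slice to be
parallel to one LINE (signs free), Giga–Miura's blow-up argument runs verbatim with the
orientation-blind quantity `min (‖ξ(x) − ξ(y)‖) (‖ξ(x) + ξ(y)‖)` (comparable to `|sin ∠(ξ(x), ξ(y))|`
for unit vectors):

* `signedAlignmentRegular` — `u ∈ 𝒦_C`, a modulus `η → 0⁺`, `d`, and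
  `min ‖ξ(t,x) ∓ ξ(t,y)‖ ≤ η(‖x − y‖)` whenever `|ω(t,x)|, |ω(t,y)| > d`, `t ∈ (−1,0)` ⇒ the origin is
  a regular point; `signedAlignmentRegular_at` — at every point of `t = 0`;
  `clockCeiling_of_signedAlignment` — `ClockCeiling`'s conclusion along such elements;
  `stub_signedAlignmentRegular` — registered form.

Contrapositive (portrait clause): near a Type-I singularity the vorticity direction is not even
asymptotically parallel-or-antiparallel at small scales: for every `d` and every modulus `η` there
are equal-time pairs of high-vorticity points with BOTH `‖ξ(x) − ξ(y)‖` and `‖ξ(x) + ξ(y)‖` exceeding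
`η(‖x − y‖)`.

## References

* Y. Giga, H. Miura, Commun. Math. Phys. 303 (2011) 289–300, Thm 1.1. [GigaMiura2011]
* P. Constantin, C. Fefferman, Indiana Univ. Math. J. 42 (1993) 775–789, Theorem (the `|sin φ|`
  condition). [ConstantinFeffermanIndiana1993]
* H. Beirão da Veiga, L. C. Berselli, Differential Integral Equations 15 (2002) (½-Hölder sine
  condition). [BeiraodaveigaBerselli2002]
-/

noncomputable section

-- the summit and its single sub-problem share the name (CONVENTIONS §1), as in every Theorems file
set_option linter.dupNamespace false

open Set Function Filter Topology Metric MeasureTheory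
open scoped RealInnerProductSpace

namespace Summit.NavierStokesRegularity.NavierStokesRegularity.Theorems

open Literature.Analysis Literature.Analysis.FluidPDE
open Summit.NavierStokesRegularity.NavierStokesRegularity.Theorems.ClockLaw.Birth

/-! ### Unidirectional slices from pairwise signed alignment -/

/-- If on a slice any two nonzero vorticity vectors are parallel or antiparallel
(`ξ(x) = ξ(y)` or `ξ(x) = −ξ(y)`), then the vorticity of the slice is everywhere parallel to one
nonzero vector (signs free). [folklore] -/
theorem exists_parallel_of_direction_eq_or_eq_neg
    {ω : EuclideanSpace ℝ (Fin 3) → EuclideanSpace ℝ (Fin 3)}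
    (h : ∀ x y, ω x ≠ 0 → ω y ≠ 0 →
      vorticityDirection ω x = vorticityDirection ω y ∨ vorticityDirection ω x = -vorticityDirection ω y) :
    ∃ e : EuclideanSpace ℝ (Fin 3), e ≠ 0 ∧ ∀ y, ∃ a : ℝ, ω y = a • e := by
  by_cases hex : ∃ x₀, ω x₀ ≠ 0
  · obtain ⟨x₀, hx₀⟩ := hex
    refine ⟨vorticityDirection ω x₀, fun h0 => hx₀ ((vorticityDirection_eq_zero_iff ω x₀).1 h0),
      fun y => ?_⟩
    by_cases hy : ω y = 0
    · exact ⟨0, by rw [hy, zero_smul]⟩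
    · have hωy : ω y = ‖ω y‖ • vorticityDirection ω y := by
        rw [vorticityDirection_apply, smul_smul, mul_inv_cancel₀ (norm_ne_zero_iff.2 hy), one_smul]
      rcases h y x₀ hy hx₀ with hpar | hanti
      · exact ⟨‖ω y‖, by rw [← hpar]; exact hωy⟩
      · refine ⟨-‖ω y‖, ?_⟩
        rw [neg_smul, ← smul_neg, ← hanti]
        exact hωy
  · push Not at hex
    refine ⟨EuclideanSpace.single 0 1, fun h0 => ?_, fun y => ⟨0, by rw [hex y, zero_smul]⟩⟩
    have := congr_arg (fun v : EuclideanSpace ℝ (Fin 3) => v 0) h0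
    simp at this

/-! ### Signed alignment forces regularity -/

/-- **Signed (orientation-blind) alignment of the vorticity direction forces regularity of a Type-I
model at the origin.** Let `u ∈ 𝒦_C`, `d ∈ ℝ`, and `η` a modulus with `η(r) → 0` as `r → 0⁺`, such that
on the slab `ℝ³ × (−1,0)`: `min ‖ξ(t,x) − ξ(t,y)‖ ‖ξ(t,x) + ξ(t,y)‖ ≤ η(‖x − y‖)` whenever
`‖ω(t,x)‖, ‖ω(t,y)‖ > d`. Then `u` is bounded on some backward parabolic cylinder `Q(0, r)`.
Giga–Miura's blow-up argument (`continuousAlignmentRegular`) with the sign-blind quantity: in the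
singular zoom limit `W ∈ 𝒦_C` any two nonzero vorticity vectors of a slice are parallel or
antiparallel, so each slice is unidirectional up to sign (`exists_parallel_of_direction_eq_or_eq_neg`)
and `W ≡ 0` by `unidirectionalVorticityLiouville` — contradicting its singularity. [cite: GigaMiura2011, Thm 1.1 (Commun. Math. Phys. 303 (2011) 289–300)] -/
theorem signedAlignmentRegular {C : ℝ}
    {u : ℝ → EuclideanSpace ℝ (Fin 3) → EuclideanSpace ℝ (Fin 3)} (hu : IsTypeIAncientMild C u)
    (hE : ∀ (x₀ : EuclideanSpace ℝ (Fin 3)) (t₀ r : ℝ), t₀ ≤ 0 → 0 < r →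
      (∀ t, t₀ - r ^ 2 < t → t < t₀ → r⁻¹ * ∫ x in Metric.ball x₀ r, ‖u t x‖ ^ 2 ≤ C) ∧
        r⁻¹ * ∫ t in Set.Ioo (t₀ - r ^ 2) t₀, ∫ x in Metric.ball x₀ r, ‖fderiv ℝ (u t) x‖ ^ 2 ≤ C)
    {d : ℝ} {η : ℝ → ℝ} (hη : Tendsto η (𝓝[>] 0) (𝓝 0))
    (halign : ∀ t ∈ Set.Ioo (-1 : ℝ) 0, ∀ x y : EuclideanSpace ℝ (Fin 3),
      d < ‖curl (u t) x‖ → d < ‖curl (u t) y‖ →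
        min ‖vorticityDirection (curl (u t)) x - vorticityDirection (curl (u t)) y‖
          ‖vorticityDirection (curl (u t)) x + vorticityDirection (curl (u t)) y‖ ≤ η ‖x - y‖) :
    ¬ (∀ r > 0, ∀ M : ℝ, ∃ t ∈ Set.Ioo (-(r ^ 2)) (0 : ℝ),
      ∃ x ∈ Metric.ball (0 : EuclideanSpace ℝ (Fin 3)) r, M < ‖u t x‖) := by
  intro hsing
  -- the zooms `u_{c_j}`, `c_j = 1/(j+1) → 0`
  set c : ℕ → ℝ := fun j => 1 / ((j : ℝ) + 1) with hcdef
  have hc : ∀ j, 0 < c j := fun j => by rw [hcdef]; positivity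
  obtain ⟨φ, hφ, W, hW, -, hpt⟩ := stub_zoomExtraction C u hu hE c hc
  -- the limit is singular at the origin, hence nonzero somewhere
  have hWsing := stub_limitSingular classPressure_holds C u hu hE hsing (fun j => c (φ j))
    (fun j => hc (φ j)) W hpt
  obtain ⟨t₀, ht₀, x₀, -, hx₀⟩ := hWsing 1 one_pos 0
  have hWne : W t₀ x₀ ≠ 0 := fun h => by simp [h] at hx₀
  -- the zoomed sequence: in the class, with the class-uniform Hessian bound
  set w : ℕ → ℝ → EuclideanSpace ℝ (Fin 3) → EuclideanSpace ℝ (Fin 3) :=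
    fun j => c (φ j) • stPull (c (φ j) ^ 2) (c (φ j)) 0 0 u with hwdef
  have hw : ∀ j, IsTypeIAncientMild C (w j) := fun j => isTypeIAncientMild_zoom hu (hc (φ j)) 0
  obtain ⟨K, -, hK⟩ := uniformBounds_exists_mixed 2 0 (-(3 : ℝ) / 2) (by norm_num)
  have h2x : ∀ n, ∀ t < 0, ∀ x, ‖iteratedFDeriv ℝ 2 (w n t) x‖ ≤ K C * (-t) ^ (-(3 : ℝ) / 2) := by
    intro n t ht x
    have := hK C (w n) (hw n) t ht x
    simpa only [iteratedDeriv_zero] using this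
  have hc0 : Tendsto (fun n => c (φ n)) atTop (𝓝 0) :=
    tendsto_one_div_add_atTop_nhds_zero_nat.comp hφ.tendsto_atTop
  -- convergence of curls and directions at a point of a negative slice
  have hcurl : ∀ t < 0, ∀ x, Tendsto (fun n => curl (w n t) x) atTop (𝓝 (curl (W t) x)) := by
    intro t ht x
    have hgrad : Tendsto (fun n => fderiv ℝ (w n t) x) atTop (𝓝 (fderiv ℝ (W t) x)) :=
      tendsto_clm_of_tendsto_apply fun e => tendsto_fderiv_apply_of_typeI hw hW hpt h2x ht x e
    simp only [curl_eq_curlCLM]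
    exact (curlCLM.continuous.tendsto _).comp hgrad
  have hξ : ∀ t < 0, ∀ x, curl (W t) x ≠ 0 → Tendsto (fun n => vorticityDirection (curl (w n t)) x)
      atTop (𝓝 (vorticityDirection (curl (W t)) x)) := by
    intro t ht x hωW
    simp only [vorticityDirection_apply]
    exact (((hcurl t ht x).norm).inv₀ (norm_ne_zero_iff.2 hωW)).smul (hcurl t ht x)
  -- eventually the un-zoomed vorticity at the zoomed point exceeds the threshold `d`
  have hbig : ∀ t < 0, ∀ x, curl (W t) x ≠ 0 →
      ∀ᶠ n in atTop, d < ‖curl (u (c (φ n) ^ 2 * t)) (c (φ n) • x)‖ := by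
    intro t ht x hωW
    have hm : 0 < ‖curl (W t) x‖ / 2 := by positivity
    have h1 : ∀ᶠ n in atTop, ‖curl (W t) x‖ / 2 < ‖curl (w n t) x‖ :=
      ((hcurl t ht x).norm).eventually (eventually_gt_nhds (by linarith [norm_pos_iff.2 hωW]))
    have h2 : ∀ᶠ n in atTop, c (φ n) * c (φ n) * d < ‖curl (W t) x‖ / 2 := by
      have hlim : Tendsto (fun n => c (φ n) * c (φ n) * d) atTop (𝓝 (0 * 0 * d)) :=
        (hc0.mul hc0).mul_const d
      rw [zero_mul, zero_mul] at hlim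
      exact hlim.eventually (eventually_lt_nhds hm)
    filter_upwards [h1, h2] with n hn1 hn2
    have hcc : 0 < c (φ n) * c (φ n) := mul_pos (hc (φ n)) (hc (φ n))
    rw [norm_curl_nsZoom_origin (hc (φ n)) u t x] at hn1
    by_contra hle
    push Not at hle
    have : c (φ n) * c (φ n) * ‖curl (u (c (φ n) ^ 2 * t)) (c (φ n) • x)‖ ≤ c (φ n) * c (φ n) * d :=
      mul_le_mul_of_nonneg_left hle hcc.le
    linarith
  -- every negative slice of the limit has vorticity parallel to one line
  have hdirW : ∀ t < 0, ∃ e : EuclideanSpace ℝ (Fin 3), e ≠ 0 ∧ ∀ y, ∃ a : ℝ, curl (W t) y = a • e := by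
    intro t ht
    refine exists_parallel_of_direction_eq_or_eq_neg fun x y hx hy => ?_
    rcases eq_or_ne x y with rfl | hxy
    · exact Or.inl rfl
    have hsep : 0 < ‖x - y‖ := norm_pos_iff.2 (sub_ne_zero.2 hxy)
    have hηn : Tendsto (fun n => η (c (φ n) * ‖x - y‖)) atTop (𝓝 0) := by
      refine hη.comp (tendsto_nhdsWithin_iff.2 ⟨?_, Eventually.of_forall fun n => ?_⟩)
      · simpa using hc0.mul_const ‖x - y‖
      · exact mul_pos (hc (φ n)) hsep
    have hct : Tendsto (fun n => c (φ n) ^ 2 * t) atTop (𝓝 0) := by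
      have := (hc0.pow 2).mul_const t
      simpa using this
    have hevT : ∀ᶠ n in atTop, -1 < c (φ n) ^ 2 * t := hct.eventually (eventually_gt_nhds (by norm_num))
    -- the signed alignment bound along the zooms
    have hev : ∀ᶠ n in atTop,
        min ‖vorticityDirection (curl (w n t)) x - vorticityDirection (curl (w n t)) y‖
          ‖vorticityDirection (curl (w n t)) x + vorticityDirection (curl (w n t)) y‖
        ≤ η (c (φ n) * ‖x - y‖) := by
      filter_upwards [hevT, hbig t ht x hx, hbig t ht y hy] with n hnT hnx hny
      have hcn : 0 < c (φ n) := hc (φ n)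
      have hct0 : c (φ n) ^ 2 * t < 0 := mul_neg_of_pos_of_neg (by positivity) ht
      have key := halign (c (φ n) ^ 2 * t) ⟨hnT, hct0⟩ (c (φ n) • x) (c (φ n) • y) hnx hny
      have hdist : ‖c (φ n) • x - c (φ n) • y‖ = c (φ n) * ‖x - y‖ := by
        rw [← smul_sub, norm_smul, Real.norm_of_nonneg hcn.le]
      rw [hdist] at key
      show min ‖vorticityDirection (curl ((c (φ n) • stPull (c (φ n) ^ 2) (c (φ n)) 0 0 u) t)) x -
            vorticityDirection (curl ((c (φ n) • stPull (c (φ n) ^ 2) (c (φ n)) 0 0 u) t)) y‖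
          ‖vorticityDirection (curl ((c (φ n) • stPull (c (φ n) ^ 2) (c (φ n)) 0 0 u) t)) x +
            vorticityDirection (curl ((c (φ n) • stPull (c (φ n) ^ 2) (c (φ n)) 0 0 u) t)) y‖ ≤
        η (c (φ n) * ‖x - y‖)
      rw [vorticityDirection_nsZoom_origin hcn, vorticityDirection_nsZoom_origin hcn]
      exact key
    have hlim : Tendsto (fun n =>
        min ‖vorticityDirection (curl (w n t)) x - vorticityDirection (curl (w n t)) y‖
          ‖vorticityDirection (curl (w n t)) x + vorticityDirection (curl (w n t)) y‖)
        atTop (𝓝 (min ‖vorticityDirection (curl (W t)) x - vorticityDirection (curl (W t)) y‖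
          ‖vorticityDirection (curl (W t)) x + vorticityDirection (curl (W t)) y‖)) :=
      (((hξ t ht x hx).sub (hξ t ht y hy)).norm).min (((hξ t ht x hx).add (hξ t ht y hy)).norm)
    have hle : min ‖vorticityDirection (curl (W t)) x - vorticityDirection (curl (W t)) y‖
        ‖vorticityDirection (curl (W t)) x + vorticityDirection (curl (W t)) y‖ ≤ 0 :=
      le_of_tendsto_of_tendsto hlim hηn hev
    rcases min_le_iff.1 hle with h1 | h2
    · exact Or.inl (sub_eq_zero.1 (norm_le_zero_iff.1 h1))
    · exact Or.inr (eq_neg_of_add_eq_zero_left (norm_le_zero_iff.1 h2))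
  have hW0 : ∀ s < 0, ∀ y, W s y = 0 := unidirectionalVorticityLiouville hW hdirW
  exact hWne (hW0 t₀ ht₀.2 x₀)

/-- **Signed alignment forces regularity at every point of the final time** (translation
covariance of `𝒦_C`, as in `continuousAlignmentRegular_at`). [cite: GigaMiura2011, Thm 1.1] -/
theorem signedAlignmentRegular_at {C : ℝ}
    {u : ℝ → EuclideanSpace ℝ (Fin 3) → EuclideanSpace ℝ (Fin 3)} (hu : IsTypeIAncientMild C u)
    (hE : ∀ (x₀ : EuclideanSpace ℝ (Fin 3)) (t₀ r : ℝ), t₀ ≤ 0 → 0 < r →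
      (∀ t, t₀ - r ^ 2 < t → t < t₀ → r⁻¹ * ∫ x in Metric.ball x₀ r, ‖u t x‖ ^ 2 ≤ C) ∧
        r⁻¹ * ∫ t in Set.Ioo (t₀ - r ^ 2) t₀, ∫ x in Metric.ball x₀ r, ‖fderiv ℝ (u t) x‖ ^ 2 ≤ C)
    {d : ℝ} {η : ℝ → ℝ} (hη : Tendsto η (𝓝[>] 0) (𝓝 0))
    (halign : ∀ t ∈ Set.Ioo (-1 : ℝ) 0, ∀ x y : EuclideanSpace ℝ (Fin 3),
      d < ‖curl (u t) x‖ → d < ‖curl (u t) y‖ →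
        min ‖vorticityDirection (curl (u t)) x - vorticityDirection (curl (u t)) y‖
          ‖vorticityDirection (curl (u t)) x + vorticityDirection (curl (u t)) y‖ ≤ η ‖x - y‖)
    (x₁ : EuclideanSpace ℝ (Fin 3)) :
    ¬ (∀ r > 0, ∀ M : ℝ, ∃ t ∈ Set.Ioo (-(r ^ 2)) (0 : ℝ),
      ∃ x ∈ Metric.ball x₁ r, M < ‖u t x‖) := by
  intro hsing
  set v : ℝ → EuclideanSpace ℝ (Fin 3) → EuclideanSpace ℝ (Fin 3) := fun t x => u t (x + x₁) with hvdef
  have hv : IsTypeIAncientMild C v := translationInvariantAfter_isTypeIAncientMild_comp_add_right hu x₁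
  have hEv := energyLedger_comp_add_right (C := C) hE x₁
  have hcurl : ∀ (t : ℝ) (x : EuclideanSpace ℝ (Fin 3)), curl (v t) x = curl (u t) (x + x₁) := by
    intro t x
    simp only [hvdef, curl, fderiv_comp_add_right]
  have hξv : ∀ (t : ℝ) (x : EuclideanSpace ℝ (Fin 3)),
      vorticityDirection (curl (v t)) x = vorticityDirection (curl (u t)) (x + x₁) := by
    intro t x
    rw [vorticityDirection_apply, vorticityDirection_apply, hcurl]
  have halignv : ∀ t ∈ Set.Ioo (-1 : ℝ) 0, ∀ x y : EuclideanSpace ℝ (Fin 3),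
      d < ‖curl (v t) x‖ → d < ‖curl (v t) y‖ →
        min ‖vorticityDirection (curl (v t)) x - vorticityDirection (curl (v t)) y‖
          ‖vorticityDirection (curl (v t)) x + vorticityDirection (curl (v t)) y‖ ≤ η ‖x - y‖ := by
    intro t ht x y hx hy
    rw [hcurl] at hx hy
    rw [hξv, hξv]
    have key := halign t ht (x + x₁) (y + x₁) hx hy
    rwa [add_sub_add_right_eq_sub] at key
  refine signedAlignmentRegular hv hEv hη halignv fun r hr M => ?_
  obtain ⟨t, ht, x, hx, hM⟩ := hsing r hr M
  refine ⟨t, ht, x - x₁, ?_, ?_⟩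
  · rwa [Metric.mem_ball, dist_zero_right, ← dist_eq_norm, ← Metric.mem_ball]
  · simpa only [hvdef, sub_add_cancel] using hM

/-- **`ClockCeiling` along every signed-aligned element of `𝒦_C`** (`signedAlignmentRegular` +
`clockCeiling_of_regularOrigin`, p152790). [cite: GigaMiura2011, Thm 1.1] -/
theorem clockCeiling_of_signedAlignment {C : ℝ}
    {u : ℝ → EuclideanSpace ℝ (Fin 3) → EuclideanSpace ℝ (Fin 3)} (hu : IsTypeIAncientMild C u)
    (hE : ∀ (x₀ : EuclideanSpace ℝ (Fin 3)) (t₀ r : ℝ), t₀ ≤ 0 → 0 < r →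
      (∀ t, t₀ - r ^ 2 < t → t < t₀ → r⁻¹ * ∫ x in Metric.ball x₀ r, ‖u t x‖ ^ 2 ≤ C) ∧
        r⁻¹ * ∫ t in Set.Ioo (t₀ - r ^ 2) t₀, ∫ x in Metric.ball x₀ r, ‖fderiv ℝ (u t) x‖ ^ 2 ≤ C)
    {d : ℝ} {η : ℝ → ℝ} (hη : Tendsto η (𝓝[>] 0) (𝓝 0))
    (halign : ∀ t ∈ Set.Ioo (-1 : ℝ) 0, ∀ x y : EuclideanSpace ℝ (Fin 3),
      d < ‖curl (u t) x‖ → d < ‖curl (u t) y‖ →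
        min ‖vorticityDirection (curl (u t)) x - vorticityDirection (curl (u t)) y‖
          ‖vorticityDirection (curl (u t)) x + vorticityDirection (curl (u t)) y‖ ≤ η ‖x - y‖) :
    ∀ δ > 0, ∃ t : ℝ, -1 ≤ t ∧ t < 0 ∧ (-t) ^ ((3 : ℝ) / 2) *
      ∫ x, ‖timeDeriv u t x‖ ^ 2 * Real.exp (-(‖x‖ ^ 2) / (4 * (-t))) < δ :=
  clockCeiling_of_regularOrigin hu hE (signedAlignmentRegular hu hE hη halign)

/-- **Stub `stub_signedAlignmentRegular` (crux stmt-NavierStokesRegularity-10570, line `registered`)**,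
in the vocabulary of the route's class `𝒦_C` (the hypotheses of `ClockCeiling` verbatim): signed
alignment of the vorticity direction on `{|ω| > d} ∩ (ℝ³ × (−1,0))` excludes a singularity at the
origin. [cite: GigaMiura2011, Thm 1.1 (Commun. Math. Phys. 303 (2011) 289–300)] -/
theorem stub_signedAlignmentRegular :
    ∀ (C : ℝ) (u : ℝ → EuclideanSpace ℝ (Fin 3) → EuclideanSpace ℝ (Fin 3)), (ContDiffOn ℝ (⊤ : ℕ∞) (Function.uncurry u) (Set.Iio 0 ×ˢ Set.univ) ∧ (∀ t < 0, Literature.Analysis.FluidPDE.VectorCalculus.IsDivFree (u t)) ∧ (∀ s t : ℝ, s < t → t < 0 → ∀ x, u t x = Literature.Analysis.FluidPDE.heatFlow (u s) (t - s) x - ∫ τ in Set.Ioo s t, ∫ y, ((-(inner ℝ (x - y) (u τ y) / (2 * (t - τ)) * Literature.Analysis.UnboundedOperators.heatKernel (t - τ) (x - y))) • u τ y + (∫ σ in Set.Ioi (t - τ), Literature.Analysis.UnboundedOperators.heatKernel σ (x - y) / (4 * σ ^ 2)) • (inner ℝ (x - y) (u τ y) • u τ y + inner ℝ (u τ y) (u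 τ y) • (x - y) + inner ℝ (x - y) (u τ y) • u τ y) - ((∫ σ in Set.Ioi (t - τ), Literature.Analysis.UnboundedOperators.heatKernel σ (x - y) / (8 * σ ^ 3)) * (inner ℝ (x - y) (u τ y) * inner ℝ (x - y) (u τ y))) • (x - y))) ∧ Literature.Analysis.FluidPDE.HasTypeITimeDecay C u ∧ (∀ (x₀ : EuclideanSpace ℝ (Fin 3)) (t₀ r : ℝ), t₀ ≤ 0 → 0 < r → (∀ t, t₀ - r ^ 2 < t → t < t₀ → r⁻¹ * ∫ x in Metric.ball x₀ r, ‖u t x‖ ^ 2 ≤ C) ∧ r⁻¹ * ∫ t in Set.Ioo (t₀ - r ^ 2) t₀, ∫ x in Metric.ball x₀ r, ‖fderiv ℝ (u t) x‖ ^ 2 ≤ C)) → ∀ (d : ℝ) (η : ℝ → ℝ), Filter.Tendsto η (nhdsWithin 0 (Set.Ioi 0)) (nhds 0) → (∀ t ∈ Set.Ioo (-1 : ℝ) 0, ∀ x y : EuclideanSpace ℝ (Fin 3), d < ‖Literature.Analysis.FluidPDE.curl (u t) x‖ → d < ‖Literature.Analysis.FluidPDE.curl (u t) y‖ → min ‖Literature.Analysis.FluidPDE.vorticityDirection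 (Literature.Analysis.FluidPDE.curl (u t)) x - Literature.Analysis.FluidPDE.vorticityDirection (Literature.Analysis.FluidPDE.curl (u t)) y‖ ‖Literature.Analysis.FluidPDE.vorticityDirection (Literature.Analysis.FluidPDE.curl (u t)) x + Literature.Analysis.FluidPDE.vorticityDirection (Literature.Analysis.FluidPDE.curl (u t)) y‖ ≤ η ‖x - y‖) → ¬ (∀ r > 0, ∀ M : ℝ, ∃ t ∈ Set.Ioo (-(r ^ 2)) (0 : ℝ), ∃ x ∈ Metric.ball (0 : EuclideanSpace ℝ (Fin 3)) r, M < ‖u t x‖) := by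
  intro C u hu d η hη halign
  have hTI : IsTypeIAncientMild C u :=
    isTypeIAncientMild_iff.2 ⟨hu.1, hu.2.1, hu.2.2.1, hu.2.2.2.1⟩
  exact signedAlignmentRegular hTI hu.2.2.2.2 hη halign

end Summit.NavierStokesRegularity.NavierStokesRegularity.Theorems

end
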